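import Mathlib.MeasureTheory.Integral.Bochner.Basic
import Mathlib.MeasureTheory.Integral.Bochner.Set
import Mathlib.MeasureTheory.Measure.Real
import HarnessLib

/-!
# LINE 27 «MedianCentring» — support workfile: the MEAN FROM THE PIECES (generic measure-theory skeleton of stub (M) `stub_meanOfMedian`)

Stub (M) of `Cruxes/HistoryTailL/Lines/median_centring.lean` recovers `E f_a ≤ θ/2` from: a nonnegative proxy `g` with `f_a ≤ g` on the event
`S = G ∩ {f_a < θ}` and `E g ≤ θ/4` (K1 + (Q): concentration of the capped McShane extension around its median), the window tail
`Gibbs({θ ≤ f_a} ∩ G) ≤ ε₁` ((T)) and the budget `Gibbs(Gᶜ) ≤ ε₂` (✓`localGood_budget`, workfile `localGood_budget_theta`), using `0 ≤ f_a ≤ 2`.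
THIS FILE isolates the two generic steps, sorry-free, for any finite measure:
* `integral_le_integral_add_of_le_on` : `f ≤ g` on `S`, `f ≤ B` and `0 ≤ g` a.e. ⇒ `∫ f ≤ ∫ g + B·μ.real Sᶜ`;
* `measureReal_compl_inter_lt_le` : `μ.real (G ∩ {f < θ})ᶜ ≤ μ.real ({θ ≤ f} ∩ G) + μ.real Gᶜ`;
* `mean_from_pieces` : the combination `∫ f ≤ ∫ g + B·(μ.real ({θ ≤ f} ∩ G) + μ.real Gᶜ)`.
Nothing about Yang–Mills is proved here (no stub of the skeleton, no crux, rung or summit; R3 = YM₃ on T³, NOT d = 4, NOT Clay).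
-/

set_option autoImplicit false

open MeasureTheory

namespace Summit.QuantumFields.YangMills.Cruxes.HistoryTailL.MedianCentring

variable {Ω : Type*} [MeasurableSpace Ω] {μ : Measure Ω}

/-- `f ≤ g` on `S`, `f ≤ B` a.e., `0 ≤ g` a.e. ⇒ `∫ f ≤ ∫ g + B · μ.real Sᶜ` (finite measure). [folklore] -/
theorem integral_le_integral_add_of_le_on [IsFiniteMeasure μ] {f g : Ω → ℝ} {B : ℝ} {S : Set Ω}
    (hS : MeasurableSet S) (hf : Integrable f μ) (hg : Integrable g μ) (hg0 : 0 ≤ᵐ[μ] g)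
    (hfB : ∀ᵐ x ∂μ, f x ≤ B) (hfg : ∀ x ∈ S, f x ≤ g x) :
    ∫ x, f x ∂μ ≤ ∫ x, g x ∂μ + B * μ.real Sᶜ := by
  have hind : Integrable (Sᶜ.indicator fun _ => B) μ := (integrable_const B).indicator hS.compl
  have hle : f ≤ᵐ[μ] fun x => g x + Sᶜ.indicator (fun _ => B) x := by
    filter_upwards [hg0, hfB] with x hx0 hxB
    by_cases hx : x ∈ S
    · have : Sᶜ.indicator (fun _ => B) x = 0 := Set.indicator_of_notMem (by simpa using hx) _
      rw [this, add_zero]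
      exact hfg x hx
    · have : Sᶜ.indicator (fun _ => B) x = B := Set.indicator_of_mem (by simpa using hx) _
      rw [this]
      have hx0' : 0 ≤ g x := by simpa using hx0
      linarith
  calc ∫ x, f x ∂μ ≤ ∫ x, (g x + Sᶜ.indicator (fun _ => B) x) ∂μ := integral_mono_ae hf (hg.add hind) hle
    _ = ∫ x, g x ∂μ + ∫ x, Sᶜ.indicator (fun _ => B) x ∂μ := integral_add hg hind
    _ = ∫ x, g x ∂μ + B * μ.real Sᶜ := by
        rw [integral_indicator_const B hS.compl, smul_eq_mul, mul_comm]

/-- `(G ∩ {f < θ})ᶜ ⊆ ({θ ≤ f} ∩ G) ∪ Gᶜ`, hence the union bound on real measures (finite measure). [folklore] -/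
theorem measureReal_compl_inter_lt_le [IsFiniteMeasure μ] {f : Ω → ℝ} {θ : ℝ} {G : Set Ω} :
    μ.real (G ∩ {x | f x < θ})ᶜ ≤ μ.real ({x | θ ≤ f x} ∩ G) + μ.real Gᶜ := by
  have hsub : (G ∩ {x | f x < θ})ᶜ ⊆ ({x | θ ≤ f x} ∩ G) ∪ Gᶜ := by
    intro x hx
    simp only [Set.mem_compl_iff, Set.mem_inter_iff, Set.mem_setOf_eq, not_and, not_lt] at hx
    by_cases hG : x ∈ G
    · exact Or.inl ⟨hx hG, hG⟩
    · exact Or.inr hG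
  exact (measureReal_mono hsub).trans (measureReal_union_le _ _)

/-- **MEAN FROM THE PIECES** (the generic skeleton of stub (M)): for a finite measure, `0 ≤ g` a.e., `f ≤ B` a.e. with `0 ≤ B`, and `f ≤ g` on
`G ∩ {f < θ}` (with `G`, `{f < θ}` measurable): `∫ f ≤ ∫ g + B·(μ.real ({θ ≤ f} ∩ G) + μ.real Gᶜ)`.  In (M): `B = 2`, `∫ g ≤ θ/4`,
`μ.real({θ ≤ f} ∩ G) ≤ θ/16` ((T) + `windowTail_le_theta`), `μ.real Gᶜ ≤ θ/16` (`localGood_budget_theta`) ⇒ `∫ f ≤ θ/2`. [folklore] -/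
theorem mean_from_pieces [IsFiniteMeasure μ] {f g : Ω → ℝ} {B θ : ℝ} {G : Set Ω}
    (hG : MeasurableSet G) (hfm : Measurable f) (hf : Integrable f μ) (hg : Integrable g μ) (hg0 : 0 ≤ᵐ[μ] g)
    (hfB : ∀ᵐ x ∂μ, f x ≤ B) (hB : 0 ≤ B) (hfg : ∀ x ∈ G ∩ {x | f x < θ}, f x ≤ g x) :
    ∫ x, f x ∂μ ≤ ∫ x, g x ∂μ + B * (μ.real ({x | θ ≤ f x} ∩ G) + μ.real Gᶜ) := by
  have hS : MeasurableSet (G ∩ {x | f x < θ}) := hG.inter (measurableSet_lt hfm measurable_const)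
  have h1 := integral_le_integral_add_of_le_on hS hf hg hg0 hfB hfg
  have h2 : B * μ.real (G ∩ {x | f x < θ})ᶜ ≤ B * (μ.real ({x | θ ≤ f x} ∩ G) + μ.real Gᶜ) :=
    mul_le_mul_of_nonneg_left measureReal_compl_inter_lt_le hB
  linarith

/-- The arithmetic of (M): `∫ g ≤ θ/4`, both exceptional masses `≤ θ/16`, `B = 2` ⇒ `∫ f ≤ θ/2`. [folklore] -/
theorem mean_from_pieces_half [IsFiniteMeasure μ] {f g : Ω → ℝ} {θ : ℝ} {G : Set Ω}
    (hG : MeasurableSet G) (hfm : Measurable f) (hf : Integrable f μ) (hg : Integrable g μ) (hg0 : 0 ≤ᵐ[μ] g)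
    (hf2 : ∀ᵐ x ∂μ, f x ≤ 2) (hfg : ∀ x ∈ G ∩ {x | f x < θ}, f x ≤ g x)
    (hEg : ∫ x, g x ∂μ ≤ θ / 4) (hT : μ.real ({x | θ ≤ f x} ∩ G) ≤ θ / 16) (hBud : μ.real Gᶜ ≤ θ / 16) :
    ∫ x, f x ∂μ ≤ θ / 2 := by
  have h := mean_from_pieces hG hfm hf hg hg0 hf2 (by norm_num) hfg
  linarith

end Summit.QuantumFields.YangMills.Cruxes.HistoryTailL.MedianCentring
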